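import Mathlib
import Summits.Ventures.PercRepro2.HCov
import Summits.Ventures.PercRepro2.HCovSwap
import Summits.Ventures.PercRepro2.ContractDefs
import Summits.Ventures.PercRepro2.RECMReduction
import Summits.Ventures.PercRepro2.GcTransport
import Summits.Ventures.PercRepro2.GcTransportMarks

/-!
# The series and leaf rules for the covariance form (blind cell PercRepro2, p1 g11; the weighted
form of LEAD-TYPED-REDUCTION §1 (a) / (c) at a root edge)

For the reduction of (HCOV) to the REDUCED class — (c-CW) only at root edges `e = {a₁, y}` whose
unmarked end `y` has degree ≥ 3 (`CCWReduced.lean`) — two root-neighbour shapes are removed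
without (c-CW):

* **`Gc_leaf`** (rule (c)): if `e = {a₁, y}` is the only non-loop edge at the unmarked `y`, then
  `Gc` does not see `e`: `Gc p ends = Gc p (ends[e ↦ loop])` (`conn_leaf_iff`);
* **`Gc_series`** (rule (a)): if `y` carries exactly one other non-loop edge `f = {y, w}`, then
  `Gc p ends = Gc p″ (G/e)` with `p″ = p[f ↦ p_e · p_f][e ↦ 0]` — the path `a₁ – y – w` is the edge
  `{a₁, w}` of weight `p_e · p_f` (`contractRootEdge ends a₁ y` sends `f` to `{a₁, w}` and `e` to a
  loop; `conn_series_iff` + `prob_series_pushforward` through `Gc_transport_marks`).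

Both lower `nonLoopCard` by one (`nonLoopCard_update_loop_lt`, `nonLoopCard_contract_lt`).
-/

namespace Summit.Ventures.PercRepro2

open CovForm Contract

namespace RECM

/-! ## Connectivity through a degree-two or degree-one root neighbour -/

section SeriesConn

variable {V : Type*} {E : Type*} [DecidableEq V] [DecidableEq E]

omit [DecidableEq E] in
/-- The contraction map of `{a₁, y}` onto `a₁` fixes every vertex other than `y`. -/
lemma contractMap_of_ne {a₁ y v : V} (hv : v ≠ y) : contractMap {a₁, y} a₁ v = v := by
  by_cases h : v = a₁
  · subst h
    exact contractMap_of_mem (Finset.mem_insert_self v {y})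
  · exact contractMap_of_notMem (by simp [h, hv])

omit [DecidableEq E] in
/-- An edge not touching `y` is unchanged by the contraction of `{a₁, y}`. -/
lemma contractRootEdge_of_notMem {ends : E → Sym2 V} {a₁ y : V} {g : E} (hg : y ∉ ends g) :
    contractRootEdge ends a₁ y g = ends g := by
  rw [contractRootEdge, contractEnds_apply]
  revert hg
  refine Sym2.inductionOn (ends g) fun u v hg => ?_
  rw [Sym2.map_mk]
  simp only [Sym2.mem_iff, not_or] at hg
  rw [contractMap_of_ne (Ne.symm hg.1), contractMap_of_ne (Ne.symm hg.2)]

omit [DecidableEq V] in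
/-- The series map off `e, f`. -/
lemma seriesMap_apply_of_ne {e f g : E} (ω : Config E) (hge : g ≠ e) (hgf : g ≠ f) :
    seriesMap e f ω g = ω g := by
  simp [seriesMap, Function.update_of_ne hge, Function.update_of_ne hgf]

omit [DecidableEq V] in
/-- The series map at `f`. -/
lemma seriesMap_apply_f {e f : E} (hef : e ≠ f) (ω : Config E) :
    seriesMap e f ω f = (ω e && ω f) := by
  simp [seriesMap, Function.update_of_ne hef.symm]

omit [DecidableEq V] in
/-- The series map at `e`. -/
lemma seriesMap_apply_e {e f : E} (ω : Config E) : seriesMap e f ω e = false := by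
  simp [seriesMap]

/-- **Connectivity through a degree-two unmarked root neighbour**: if `e = {a₁, y}` and
`f = {y, w}` are the only non-loop edges at `y`, then for `x, z ≠ y` connectivity in `G` under
`ω` is connectivity in `G/e` under the series configuration `ω[f ↦ ω_e ∧ ω_f][e ↦ false]`. -/
theorem conn_series_iff {ends : E → Sym2 V} {e f : E} {a₁ y w : V} (hg : ends e = s(a₁, y))
    (hf : ends f = s(y, w)) (hef : e ≠ f) (hay : a₁ ≠ y) (hyw : y ≠ w)
    (hdeg : ∀ g, g ≠ e → g ≠ f → y ∈ ends g → (ends g).IsDiag) (ω : Config E) {x z : V}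
    (hx : x ≠ y) (hz : z ≠ y) :
    Conn (contractRootEdge ends a₁ y) (seriesMap e f ω) x z ↔ Conn ends ω x z := by
  set ends' := contractRootEdge ends a₁ y with hends'
  set ω' := seriesMap e f ω with hω'
  have hf' : ends' f = s(a₁, w) := by
    rw [hends', contractRootEdge, contractEnds_apply, hf, Sym2.map_mk,
      contractMap_of_mem (Finset.mem_insert_of_mem (Finset.mem_singleton_self y)),
      contractMap_of_ne hyw.symm]
  have he' : (ends' e).IsDiag := isDiag_contractRootEdge hg
  -- an edge other than `e, f` is unchanged and keeps its state
  have hother : ∀ g, g ≠ e → g ≠ f → ¬ (ends g).IsDiag → ends' g = ends g ∧ ω' g = ω g := by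
    intro g hge hgf hnd
    refine ⟨contractRootEdge_of_notMem fun hy => hnd (hdeg g hge hgf hy), ?_⟩
    rw [hω', seriesMap_apply_of_ne ω hge hgf]
  constructor
  · intro h
    let S : Set V := {v | Conn ends ω x v}
    have hS : ∀ u ∈ S, ∀ v, (openGraph ends' ω').Adj u v → v ∈ S := by
      intro u hu v hadj
      obtain ⟨huv, g, hgo, hge⟩ := openGraph_adj.1 hadj
      by_cases hgee : g = e
      · subst hgee
        exact absurd (hge ▸ he') (by rw [Sym2.mk_isDiag_iff]; exact huv)
      by_cases hgf : g = f
      · subst hgf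
        rw [hω', seriesMap_apply_f hef] at hgo
        rw [hf'] at hge
        have hpath : Conn ends ω a₁ w :=
          conn_trans (conn_of_openAdj ⟨e, (Bool.and_eq_true _ _).mp hgo |>.1, hg⟩)
            (conn_of_openAdj ⟨g, (Bool.and_eq_true _ _).mp hgo |>.2, hf⟩)
        rw [Sym2.eq_iff] at hge
        rcases hge with ⟨rfl, rfl⟩ | ⟨rfl, rfl⟩
        · exact conn_trans hu hpath
        · exact conn_trans hu (conn_symm hpath)
      · have hnd : ¬ (ends g).IsDiag := by
          intro hd
          have := isDiag_contract_of_isDiag ends {a₁, y} a₁ hd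
          rw [← contractRootEdge, ← hends', hge, Sym2.mk_isDiag_iff] at this
          exact huv this
        obtain ⟨h1, h2⟩ := hother g hgee hgf hnd
        rw [h1] at hge
        rw [h2] at hgo
        exact conn_trans hu (conn_of_openAdj ⟨g, hgo, hge⟩)
    exact mem_of_conn_of_closed hS (conn_refl ends ω x) h
  · intro h
    let S : Set V := {v | (v ≠ y ∧ Conn ends' ω' x v) ∨
      (v = y ∧ ((ω e = true ∧ Conn ends' ω' x a₁) ∨ (ω f = true ∧ Conn ends' ω' x w)))}
    have hxS : x ∈ S := Or.inl ⟨hx, conn_refl _ _ _⟩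
    -- with both `e` and `f` open, `a₁ ↔ w` in `G/e`
    have hbridge : ω e = true → ω f = true → Conn ends' ω' a₁ w := by
      intro he hfo
      have : ω' f = true := by rw [hω', seriesMap_apply_f hef, he, hfo]; rfl
      exact conn_of_openAdj ⟨f, this, hf'⟩
    have hS : ∀ u ∈ S, ∀ v, (openGraph ends ω).Adj u v → v ∈ S := by
      intro u hu v hadj
      obtain ⟨huv, g, hgo, hge⟩ := openGraph_adj.1 hadj
      by_cases hgee : g = e
      · subst hgee
        rw [hg, Sym2.eq_iff] at hge
        rcases hge with ⟨rfl, rfl⟩ | ⟨rfl, rfl⟩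
        · -- `u = a₁`, `v = y`
          rcases hu with ⟨_, hc⟩ | ⟨hy, _⟩
          · exact Or.inr ⟨rfl, Or.inl ⟨hgo, hc⟩⟩
          · exact absurd hy hay
        · -- `u = y`, `v = a₁`
          rcases hu with ⟨hy, _⟩ | ⟨_, hc⟩
          · exact absurd rfl hy
          · refine Or.inl ⟨hay, ?_⟩
            rcases hc with ⟨_, hc⟩ | ⟨hfo, hc⟩
            · exact hc
            · exact conn_trans hc (conn_symm (hbridge hgo hfo))
      by_cases hgf : g = f
      · subst hgf
        rw [hf, Sym2.eq_iff] at hge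
        rcases hge with ⟨rfl, rfl⟩ | ⟨rfl, rfl⟩
        · -- `u = y`, `v = w`
          rcases hu with ⟨hy, _⟩ | ⟨_, hc⟩
          · exact absurd rfl hy
          · refine Or.inl ⟨hyw.symm, ?_⟩
            rcases hc with ⟨he, hc⟩ | ⟨_, hc⟩
            · exact conn_trans hc (hbridge he hgo)
            · exact hc
        · -- `u = w`, `v = y`
          rcases hu with ⟨_, hc⟩ | ⟨hy, _⟩
          · exact Or.inr ⟨rfl, Or.inr ⟨hgo, hc⟩⟩
          · exact absurd hy hyw.symm
      · have hnd : ¬ (ends g).IsDiag := by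
          rw [hge, Sym2.mk_isDiag_iff]
          exact huv
        have hyg : y ∉ ends g := fun hy => hnd (hdeg g hgee hgf hy)
        obtain ⟨h1, h2⟩ := hother g hgee hgf hnd
        have huy : u ≠ y := fun h => hyg (h ▸ hge ▸ Sym2.mem_mk_left u v)
        have hvy : v ≠ y := fun h => hyg (h ▸ hge ▸ Sym2.mem_mk_right u v)
        rcases hu with ⟨_, hc⟩ | ⟨hy, _⟩
        · exact Or.inl ⟨hvy, conn_trans hc (conn_of_openAdj ⟨g, h2 ▸ hgo, h1 ▸ hge⟩)⟩
        · exact absurd hy huy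
    have hzS := mem_of_conn_of_closed hS hxS h
    rcases hzS with ⟨_, hc⟩ | ⟨hy, _⟩
    · exact hc
    · exact absurd hy hz

omit [DecidableEq V] in
/-- **Connectivity through an unmarked leaf at a root**: if `e = {a₁, y}` is the only non-loop edge
at `y`, then for `x, z ≠ y` connectivity in `G` is connectivity in `G` with `e` re-routed to a loop. -/
theorem conn_leaf_iff {ends : E → Sym2 V} {e : E} {a₁ y : V} (hg : ends e = s(a₁, y))
    (hay : a₁ ≠ y) (hleaf : ∀ g, g ≠ e → y ∈ ends g → (ends g).IsDiag) (ω : Config E) {x z : V}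
    (hx : x ≠ y) (hz : z ≠ y) :
    Conn ends ω x z ↔ Conn (Function.update ends e s(a₁, a₁)) ω x z := by
  set ends' := Function.update ends e s(a₁, a₁) with hends'
  constructor
  · intro h
    let S : Set V := {v | (v = y ∧ Conn ends' ω x a₁) ∨ (v ≠ y ∧ Conn ends' ω x v)}
    have hxS : x ∈ S := Or.inr ⟨hx, conn_refl _ _ _⟩
    have hS : ∀ u ∈ S, ∀ v, (openGraph ends ω).Adj u v → v ∈ S := by
      intro u hu v hadj
      obtain ⟨huv, g, hgo, hge⟩ := openGraph_adj.1 hadj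
      by_cases hgee : g = e
      · subst hgee
        rw [hg, Sym2.eq_iff] at hge
        rcases hge with ⟨rfl, rfl⟩ | ⟨rfl, rfl⟩
        · rcases hu with ⟨hy, _⟩ | ⟨_, hc⟩
          · exact absurd hy hay
          · exact Or.inl ⟨rfl, hc⟩
        · rcases hu with ⟨_, hc⟩ | ⟨hy, _⟩
          · exact Or.inr ⟨hay, hc⟩
          · exact absurd rfl hy
      · have hnd : ¬ (ends g).IsDiag := by
          rw [hge, Sym2.mk_isDiag_iff]
          exact huv
        have hyg : y ∉ ends g := fun hy => hnd (hleaf g hgee hy)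
        have huy : u ≠ y := fun h => hyg (h ▸ hge ▸ Sym2.mem_mk_left u v)
        have hvy : v ≠ y := fun h => hyg (h ▸ hge ▸ Sym2.mem_mk_right u v)
        have hge' : ends' g = s(u, v) := by rw [hends', Function.update_of_ne hgee, hge]
        rcases hu with ⟨hy, _⟩ | ⟨_, hc⟩
        · exact absurd hy huy
        · exact Or.inr ⟨hvy, conn_trans hc (conn_of_openAdj ⟨g, hgo, hge'⟩)⟩
    have hzS := mem_of_conn_of_closed hS hxS h
    rcases hzS with ⟨hy, _⟩ | ⟨_, hc⟩
    · exact absurd hy hz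
    · exact hc
  · intro h
    let S : Set V := {v | Conn ends ω x v}
    have hS : ∀ u ∈ S, ∀ v, (openGraph ends' ω).Adj u v → v ∈ S := by
      intro u hu v hadj
      obtain ⟨huv, g, hgo, hge⟩ := openGraph_adj.1 hadj
      by_cases hgee : g = e
      · subst hgee
        rw [hends', Function.update_self, Sym2.eq_iff] at hge
        rcases hge with ⟨rfl, rfl⟩ | ⟨rfl, rfl⟩ <;> exact absurd rfl huv
      · rw [hends', Function.update_of_ne hgee] at hge
        exact conn_trans hu (conn_of_openAdj ⟨g, hgo, hge⟩)
    exact mem_of_conn_of_closed hS (conn_refl ends ω x) h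

end SeriesConn

/-! ## The leaf and series rules for `Gc` -/

section Rules

variable {V : Type*} {E : Type*} [Fintype E] [DecidableEq E] [DecidableEq V] {R : Type*}
  [Field R] [LinearOrder R]

omit [Fintype E] [DecidableEq E] [DecidableEq V] in
/-- An unmarked vertex is none of the marks. -/
lemma ne_of_mem_marks {o a₁ a₂ a₃ b y x : V} (hy : Unmarked o a₁ a₂ a₃ b y)
    (hx : x ∈ ({o, a₁, a₂, a₃, b} : Set V)) : x ≠ y := by
  obtain ⟨hyo, hy1, hy2, hy3, hyb⟩ := hy
  simp only [Set.mem_insert_iff, Set.mem_singleton_iff] at hx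
  rcases hx with rfl | rfl | rfl | rfl | rfl
  · exact hyo.symm
  · exact hy1.symm
  · exact hy2.symm
  · exact hy3.symm
  · exact hyb.symm

omit [DecidableEq V] [LinearOrder R] in
/-- **The leaf rule**: an unmarked leaf `y` hanging at the root by `e = {a₁, y}` is invisible —
`Gc` of `G` is `Gc` of `G` with `e` re-routed to a loop (same weights). -/
theorem Gc_leaf (p : E → R) {ends : E → Sym2 V} {e : E} {o a₁ a₂ a₃ b y : V}
    (hg : ends e = s(a₁, y)) (hy : Unmarked o a₁ a₂ a₃ b y)
    (hleaf : ∀ g, g ≠ e → y ∈ ends g → (ends g).IsDiag) :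
    Gc p ends o a₁ a₂ a₃ b = Gc p (Function.update ends e s(a₁, a₁)) o a₁ a₂ a₃ b :=
  Gc_transport_marks (Ψ := id) (φ := id) (fun A => by simp) o a₁ a₂ a₃ b
    (fun ω _ hx _ hz => conn_leaf_iff hg hy.2.1.symm hleaf ω (ne_of_mem_marks hy hx)
      (ne_of_mem_marks hy hz))

omit [LinearOrder R] in
/-- **The series rule**: if the unmarked root neighbour `y` has exactly the two non-loop edges
`e = {a₁, y}` and `f = {y, w}`, then `Gc` of `G` is `Gc` of `G/e` (where `f` has become `{a₁, w}`
and `e` a loop) with the weights `p[f ↦ p_e · p_f][e ↦ 0]`. -/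
theorem Gc_series (p : E → R) {ends : E → Sym2 V} {e f : E} {o a₁ a₂ a₃ b y w : V}
    (hg : ends e = s(a₁, y)) (hf : ends f = s(y, w)) (hef : e ≠ f) (hyw : y ≠ w)
    (hy : Unmarked o a₁ a₂ a₃ b y) (hdeg : ∀ g, g ≠ e → g ≠ f → y ∈ ends g → (ends g).IsDiag) :
    Gc p ends o a₁ a₂ a₃ b =
      Gc (Function.update (Function.update p f (p e * p f)) e 0) (contractRootEdge ends a₁ y)
        o a₁ a₂ a₃ b :=
  (Gc_transport_marks (φ := id) (prob_series_pushforward p hef) o a₁ a₂ a₃ b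
    (fun ω _ hx _ hz => conn_series_iff hg hf hef hy.2.1.symm hyw hdeg ω (ne_of_mem_marks hy hx)
      (ne_of_mem_marks hy hz))).symm

end Rules

end RECM

end Summit.Ventures.PercRepro2
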